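import Mathlib.Computability.Encoding
import Literature.Computability.Cryptography.ClassBQP
import Literature.NumberTheory.QuadraticFields.ReducedForms
import Literature.NumberTheory.LFunctions.AutomorphicGRH
import HarnessLib

/-!
# Class numbers of imaginary quadratic fields in quantum polynomial time under GRH (Hallgren 2005)

Topic `Literature/Computability/Cryptography` (next to `Shor.lean` / `factoring_mem_FBQP`); cite/fact
item `wi-10105` for route QuantumAdvantage/ArithStatLadder (crux `IqThreeMemBQP`,
`stmt-QuantumAdvantage-2424`: `IQ3 ∈ BQP`).

Sources.

* S. Hallgren, *Fast quantum algorithms for computing the unit group and class group of a number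
  field*, STOC 2005, 468–474, doi:10.1145/1060590.1060660 (`Hallgren2005`; paywalled here,
  acquisition request acq-01945): polynomial-time quantum algorithms for the unit group and the class
  group of a number field of constant degree, assuming GRH.
* J.-F. Biasse, F. Song, SODA 2016 (`BiasseSong2015`; acq-01948): the same in arbitrary degree.
* A. M. Childs, W. van Dam, *Quantum algorithms for algebraic problems*, Rev. Mod. Phys. 82 (2010) =
  arXiv:0812.0380 (`ChildsVandam2010`; READ, held copy p. 24, §5.7), the secondary source from which
  the statement is vendored: "The class group problem asks us to decompose `Cl(K)` … Assuming the
  generalized Riemann hypothesis (GRH), there is a polynomial-time algorithm to find generators of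
  `Cl(K)` [Thi95]. If `K = ℚ[√−d]` is an imaginary quadratic number field, then its elements have
  unique representatives that can be computed efficiently, and `Cl(K)` can be decomposed using the
  procedure of [Mos99, CM01]. … there is an efficient quantum algorithm for decomposing `Cl(K)`,
  provided `K` has constant degree and assuming the GRH [Hal05] … In particular, we can efficiently
  compute `|Cl(K)|`, the class number of the number field `K`."

## Tree form

`Hallgren2005_classNumber_qsolvable_of_GRH`: under the tree's `GrandRiemannHypothesisGL` (GRH for all
automorphic `L`-functions of `GL_n/ℚ`, `AutomorphicGRH.lean` — STRONGER than the GRH the print needs,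
that of the Hecke `L`-functions of `ℚ(√−d)`, which are automorphic for `GL₂`; assuming more makes the
vendored implication weaker), the search problem "on input `bin(d)` with `−d` a (negative) fundamental
discriminant, output `bin(h(−d))`" is solvable in bounded-error quantum polynomial time in the tree's
strict sense (`IsQSolvable`: a `P`-uniform oracle-free Clifford+T family measured on all wires
outputs, with probability `≥ 2/3`, a string with the required prefix — the model of
`factoring_mem_FBQP`), where `h = BinaryQuadraticForm.classNumber` (number of reduced forms of
discriminant `−d` = `|Cl(𝓞_K)|`, `K = ℚ(√−d)`, the route's `h`) and inputs that are not fundamental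
discriminants carry no requirement (any output is accepted). Outputting the class NUMBER instead of
the invariant-factor decomposition is the printed "in particular"; degree `2` is a constant degree.
Fundamentality of `−d` is spelled out exactly as in the route file (`d ≡ 3 (mod 4)` squarefree, or
`4 ∣ d` with `d/4 ≡ 1, 2 (mod 4)` squarefree, phrased on `−d`). Not in Mathlib; stated as a `Prop`.
The decision corollary `IQ3 ∈ BQP` (run the algorithm, test `3 ∣ h`) is the route item itself and is
left to its prover (composition of uniform families as in route Shor).
-/

noncomputable section

namespace Literature.Computability.Cryptography

open _root_.Computability Literature.NumberTheory.LFunctions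
open Literature.NumberTheory.QuadraticFields

/-- **`−d` is a negative fundamental discriminant**, for `d : ℕ`, spelled out as in route
QuantumAdvantage/ArithStatLadder (`IqThreeMemBQP`): `−d ≡ 1 (mod 4)`, squarefree and `≠ 1`, or
`4 ∣ −d` with `(−d)/4 ≡ 2, 3 (mod 4)` and `(−d)/4` squarefree (Cox 2013, §3.A / Thm 3.9 context).
[folklore] -/
def IsNegFundamentalDiscr (d : ℕ) : Prop :=
  ((-(d : ℤ)) % 4 = 1 ∧ Squarefree (-(d : ℤ)) ∧ (-(d : ℤ)) ≠ 1) ∨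
    (4 ∣ (-(d : ℤ)) ∧ ((-(d : ℤ)) / 4 % 4 = 2 ∨ (-(d : ℤ)) / 4 % 4 = 3) ∧ Squarefree ((-(d : ℤ)) / 4))

/-- `−3` is a fundamental discriminant (`d = 3`: `−3 ≡ 1 (mod 4)`, squarefree). [folklore] -/
theorem isNegFundamentalDiscr_three : IsNegFundamentalDiscr 3 := by
  left
  refine ⟨by decide, ?_, by decide⟩
  have h3 : Prime (-3 : ℤ) := Int.prime_iff_natAbs_prime.2 (by norm_num)
  exact h3.squarefree

/-- **Hallgren 2005 (via Childs–van Dam 2010, §5.7): class numbers of imaginary quadratic fields are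
computable in quantum polynomial time under GRH.** Printed (survey): "there is an efficient quantum
algorithm for decomposing `Cl(K)`, provided `K` has constant degree and assuming the GRH [Hal05] … In
particular, we can efficiently compute `|Cl(K)|`"; for `K = ℚ[√−d]` "its elements have unique
representatives that can be computed efficiently, and `Cl(K)` can be decomposed using the procedure
of [Mos99, CM01]" (generators under GRH, [Thi95]). Tree form: `GrandRiemannHypothesisGL →` the search
problem `bin(d) ↦ bin(h(−d))` on negative fundamental discriminants `−d` (no requirement on other
inputs) is `IsQSolvable` (uniform Clifford+T family, success `≥ 2/3`, answer as an output prefix),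
`h = BinaryQuadraticForm.classNumber (−d)`. Weaker than printed (class number rather than the group
structure; Grand RH rather than GRH for `ζ_K`/Hecke `L`-functions). Not in Mathlib; stated as a `Prop`.
[cite: ChildsVandam2010, §5.7 (p. 24 of arXiv:0812.0380)] [cite: Hallgren2005] -/
def Hallgren2005_classNumber_qsolvable_of_GRH : Prop :=
  GrandRiemannHypothesisGL →
    IsQSolvable fun x : List Bool =>
      {y | IsNegFundamentalDiscr (decodeNat x) →
        encodeNat (BinaryQuadraticForm.classNumber (-(decodeNat x : ℤ))) <+: y}

end Literature.Computability.Cryptography
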